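import Mathlib
import Literature.Probability.PointProcesses.LensConsistentLaw
import Literature.MathematicalPhysics.StatisticalMechanics.LennardJonesClusters
import Literature.MathematicalPhysics.StatisticalMechanics.BarlowStacking
import Literature.Probability.Process.RootedHardCoreVague
import Literature.Probability.Process.PointStationaryLaw
import Summits.AtomisticToContinuum.Crystallization.Theorems.FrustrationRangeCertificatesPatternPricedCertificatesStubLevelLift
import Summits.AtomisticToContinuum.Crystallization.Theorems.FrustrationRangeCertificatesPatternPricedCertificatesStubMeanDuality
import Summits.AtomisticToContinuum.Crystallization.Theorems.PalmUnimodularRigidityBenjaminiSchrammLimitContinuity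
import Summits.AtomisticToContinuum.Crystallization.Theorems.FrustrationRangeCertificatesPatternPricedCertificatesStubMeanCampbellAux
import HarnessLib

/-!
# Crux `PatternPricedCertificates` (stmt-AtomisticToContinuum-12974), line `registered`: stub `stub_meanCampbell`

The Campbell / re-rooting identity of the law representing a point-stationary mean family, on continuous local test
functions. Bridge stub B2a of the line.

Proof. Both Campbell integrands `F₁ S = Σ_{y ∈ S} G(S, y)` and `F₂ S = Σ_{y ∈ S} G(S − y, −y)` are continuous on the
compact configuration space (`continuous_integral_of_continuousOn`, `continuousOn_reroot`), hence `Q`-integrable, so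
it suffices that `∫ (F₁ − F₂) dQ = 0`, which the representation reduces to `ℓ n ((F₁ − F₂) ∘ ι) → 0`. On an admissible
pattern `(F₁ − F₂)(ι T)` is, up to `η`, the level-`(r, n)` transport of the bounded rule `1[‖v‖ ≤ R] G(ι p, v)`
(`meanCampbell_levelEstimate`, module `…StubMeanCampbellAux`), which `ℓ n` kills (lens-consistency); means of
functions with values in `[−η, η]` on admissible patterns lie in `[−η, η]`.
-/

noncomputable section

open scoped BigOperators Classical
open MeasureTheory

namespace Summit.AtomisticToContinuum.Crystallization.Theorems.PatternPricedCertificates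

open Literature.Probability.PointProcesses (IsRootedPattern ballPattern lens reroot)
open Literature.Probability.Process
open Summit.AtomisticToContinuum.Crystallization.Theorems.BenjaminiSchrammLimit

section CampbellIntegrands

/-- The first Campbell integrand `S ↦ ∫ G(S, y) d(count|S) = Σ_{y ∈ S} G(S, y)` is continuous on the
configuration space (a local sum with configuration-dependent summand). [folklore] -/
theorem meanCampbell_continuous_left {δ : ℝ} (hδ : 0 < δ)
    {G : LocalConfig.RootedHardCoreConfig (EuclideanSpace ℝ (Fin 3)) δ × (EuclideanSpace ℝ (Fin 3)) → ℝ}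
    (hG : Continuous G) {R : ℝ} (hR : ∀ S y, R < ‖y‖ → G (S, y) = 0) :
    Continuous fun S : LocalConfig.RootedHardCoreConfig (EuclideanSpace ℝ (Fin 3)) δ =>
      ∫ y, G (S, y) ∂(LocalConfig.toMeasure S.1) :=
  continuous_integral_of_continuousOn hδ hG.continuousOn (R := R) fun p hp => hR p.1 p.2 hp

/-- The second Campbell integrand `S ↦ Σ_{y ∈ S} G(S − y, −y)` is continuous on the configuration space
(the re-rooting involution is continuous on the incidence set). [folklore] -/
theorem meanCampbell_continuous_right {δ : ℝ} (hδ : 0 < δ)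
    {G : LocalConfig.RootedHardCoreConfig (EuclideanSpace ℝ (Fin 3)) δ × (EuclideanSpace ℝ (Fin 3)) → ℝ}
    (hG : Continuous G) {R : ℝ} (hR : ∀ S y, R < ‖y‖ → G (S, y) = 0) :
    Continuous fun S : LocalConfig.RootedHardCoreConfig (EuclideanSpace ℝ (Fin 3)) δ =>
      ∫ y, (if h : y ∈ ((↑S.1 : Set (EuclideanSpace ℝ (Fin 3)))) then G (S.reroot y h, -y) else 0)
        ∂(LocalConfig.toMeasure S.1) := by
  have hΨ : ContinuousOn (fun p : LocalConfig.RootedHardCoreConfig (EuclideanSpace ℝ (Fin 3)) δ ×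
      (EuclideanSpace ℝ (Fin 3)) => (if h : p.2 ∈ ((↑p.1.1 : Set (EuclideanSpace ℝ (Fin 3)))) then
        G (p.1.reroot p.2 h, -p.2) else 0))
      {p | p.2 ∈ ((↑p.1.1 : Set (EuclideanSpace ℝ (Fin 3))))} := by
    refine (hG.comp_continuousOn (continuousOn_reroot (E := EuclideanSpace ℝ (Fin 3)) (δ := δ))).congr ?_
    intro p hp
    have hp' : p.2 ∈ ((↑p.1.1 : Set (EuclideanSpace ℝ (Fin 3)))) := hp
    simp only [Function.comp, dif_pos hp']
  exact continuous_integral_of_continuousOn hδ hΨ (R := R) fun p hp => by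
    show (if h : p.2 ∈ ((↑p.1.1 : Set (EuclideanSpace ℝ (Fin 3)))) then G (p.1.reroot p.2 h, -p.2) else 0) = 0
    split_ifs with h
    · exact hR _ _ (by rwa [norm_neg])
    · rfl

end CampbellIntegrands

/-- **Stub B2a (the Campbell identity of the represented law).** For `Q` representing the point-stationary mean
family `ℓ` (as in `stub_meanToLaw`) and every continuous bounded `G(S, y)` vanishing for `‖y‖ > R`:
`∫ Σ_{y ∈ S} G(S, y) dQ = ∫ Σ_{y ∈ S} G(S − y, −y) dQ` (both integrands are continuous on the compact configuration
space; on a finite pattern the difference is a finite-range transport of `ℓ` up to the modulus of continuity of `G` at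
the scale where configurations agreeing on a large ball are close in the local rubber metric, so `ℓ n` of it tends to
`0`, and the representation pins the integral). [folklore] -/
theorem stub_meanCampbell :
    ∀ δ : ℝ, 0 < δ → ∀ ι : Finset (EuclideanSpace ℝ (Fin 3)) → Literature.Probability.Process.LocalConfig.RootedHardCoreConfig (EuclideanSpace ℝ (Fin 3)) δ, (∀ (ρ : ℝ) (T : Finset (EuclideanSpace ℝ (Fin 3))), Literature.Probability.PointProcesses.IsRootedPattern δ ρ T → ((↑(ι T).1 : Set (EuclideanSpace ℝ (Fin 3)))) = insert (0 : (EuclideanSpace ℝ (Fin 3))) (↑T : Set (EuclideanSpace ℝ (Fin 3)))) → ∀ ℓ : ℝ → (Finset (EuclideanSpace ℝ (Fin 3)) → ℝ) → ℝ,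
      (∀ (ρ : ℝ) (f₁ f₂ : Finset (EuclideanSpace ℝ (Fin 3)) → ℝ), ℓ ρ (f₁ + f₂) = ℓ ρ f₁ + ℓ ρ f₂) →
      (∀ (ρ t : ℝ) (f : Finset (EuclideanSpace ℝ (Fin 3)) → ℝ), ℓ ρ (t • f) = t * ℓ ρ f) →
      (∀ (ρ : ℝ) (f : Finset (EuclideanSpace ℝ (Fin 3)) → ℝ), (∀ S : Finset (EuclideanSpace ℝ (Fin 3)), Literature.Probability.PointProcesses.IsRootedPattern δ ρ S → 0 ≤ f S ∧ f S ≤ 1) → 0 ≤ ℓ ρ f) →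
      (∀ ρ : ℝ, ℓ ρ (fun _ => 1) = 1) →
      (∀ ρ ρ' : ℝ, ρ ≤ ρ' → ∀ f : Finset (EuclideanSpace ℝ (Fin 3)) → ℝ, ℓ ρ' (fun S => f (Literature.Probability.PointProcesses.ballPattern ρ S)) = ℓ ρ f) →
      (∀ r ρ : ℝ, 0 ≤ r → ∀ g : (EuclideanSpace ℝ (Fin 3)) → Finset (EuclideanSpace ℝ (Fin 3)) → Finset (EuclideanSpace ℝ (Fin 3)) → ℝ, (∃ M : ℝ, ∀ v p q, |g v p q| ≤ M) → ℓ ρ (fun S => ∑ v ∈ Literature.Probability.PointProcesses.lens r ρ S, (g v (Literature.Probability.PointProcesses.ballPattern r S) (Literature.Probability.PointProcesses.ballPattern r (Literature.Probability.PointProcesses.reroot S v)) - g (-v) (Literature.Probability.PointProcesses.ballPattern r (Literature.Probability.PointProcesses.reroot S v)) (Literature.Probability.PointProcesses.ballPattern r S))) = 0) →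
      ∀ Q : MeasureTheory.Measure (Literature.Probability.Process.LocalConfig.RootedHardCoreConfig (EuclideanSpace ℝ (Fin 3)) δ), MeasureTheory.IsProbabilityMeasure Q →
      (∀ F : Literature.Probability.Process.LocalConfig.RootedHardCoreConfig (EuclideanSpace ℝ (Fin 3)) δ → ℝ, Continuous F → ∀ c : ℝ, ((∃ n₀ : ℕ, ∀ n : ℕ, n₀ ≤ n → c ≤ ℓ (n : ℝ) (fun T => F (ι T))) → c ≤ ∫ x, F x ∂Q) ∧ ((∃ n₀ : ℕ, ∀ n : ℕ, n₀ ≤ n → ℓ (n : ℝ) (fun T => F (ι T)) ≤ c) → ∫ x, F x ∂Q ≤ c)) →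
      ∀ G : Literature.Probability.Process.LocalConfig.RootedHardCoreConfig (EuclideanSpace ℝ (Fin 3)) δ × (EuclideanSpace ℝ (Fin 3)) → ℝ, Continuous G → (∃ R : ℝ, ∀ S y, R < ‖y‖ → G (S, y) = 0) →
        (∃ M : ℝ, ∀ p, |G p| ≤ M) →
        ∫ S, (∫ y, G (S, y) ∂(Literature.Probability.Process.LocalConfig.toMeasure S.1)) ∂Q =
          ∫ S, (∫ y, (if h : y ∈ ((↑S.1 : Set (EuclideanSpace ℝ (Fin 3)))) then G (S.reroot y h, -y) else 0) ∂(Literature.Probability.Process.LocalConfig.toMeasure S.1)) ∂Q := by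
  intro δ hδ ι hι ℓ H1 H2 H3 H4 _H5 H6 Q hQ hrepr G hG hGR hGM
  obtain ⟨R, hR⟩ := hGR
  obtain ⟨M, hM⟩ := hGM
  haveI : Fact (0 < δ) := ⟨hδ⟩
  -- the two Campbell integrands: continuous on the compact configuration space, hence `Q`-integrable
  set F₁ : LocalConfig.RootedHardCoreConfig (EuclideanSpace ℝ (Fin 3)) δ → ℝ :=
    fun S => ∫ y, G (S, y) ∂(LocalConfig.toMeasure S.1) with hF₁
  set F₂ : LocalConfig.RootedHardCoreConfig (EuclideanSpace ℝ (Fin 3)) δ → ℝ :=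
    fun S => ∫ y, (if h : y ∈ ((↑S.1 : Set (EuclideanSpace ℝ (Fin 3)))) then G (S.reroot y h, -y) else 0)
      ∂(LocalConfig.toMeasure S.1) with hF₂
  have hc₁ : Continuous F₁ := meanCampbell_continuous_left hδ hG hR
  have hc₂ : Continuous F₂ := meanCampbell_continuous_right hδ hG hR
  have hi₁ : Integrable F₁ Q := hc₁.integrable_of_hasCompactSupport (HasCompactSupport.of_compactSpace F₁)
  have hi₂ : Integrable F₂ Q := hc₂.integrable_of_hasCompactSupport (HasCompactSupport.of_compactSpace F₂)
  have hcF : Continuous fun S => F₁ S - F₂ S := hc₁.sub hc₂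
  -- it suffices that `∫ (F₁ - F₂) dQ = 0`
  suffices h0 : ∫ S, (F₁ S - F₂ S) ∂Q = 0 by
    rw [integral_sub hi₁ hi₂, sub_eq_zero] at h0
    exact h0
  -- at every level `n ≥ r + R`, `ℓ n ((F₁ - F₂) ∘ ι)` is within `η` of the transport, which `ℓ n` kills
  have key : ∀ η : ℝ, 0 < η → ∃ n₀ : ℕ, ∀ n : ℕ, n₀ ≤ n →
      |ℓ (n : ℝ) (fun T => F₁ (ι T) - F₂ (ι T))| ≤ η := by
    intro η hη
    obtain ⟨r, hr, hest⟩ := meanCampbell_levelEstimate δ hδ ι hι G hG R hR η hη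
    refine ⟨⌈r + R⌉₊, fun n hn => ?_⟩
    have hnr : r + R ≤ (n : ℝ) := (Nat.le_ceil (r + R)).trans (by exact_mod_cast hn)
    have h6 := H6 r n hr.le (fun v p _ => if ‖v‖ ≤ R then G (ι p, v) else 0) ⟨M, fun v p q => by
      show |(if ‖v‖ ≤ R then G (ι p, v) else 0)| ≤ M
      split_ifs
      · exact hM _
      · rw [abs_zero]; exact (abs_nonneg _).trans (hM (ι p, v))⟩
    beta_reduce at h6
    set Tr : Finset (EuclideanSpace ℝ (Fin 3)) → ℝ := fun S => ∑ v ∈ lens r n S,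
      ((if ‖v‖ ≤ R then G (ι (ballPattern r S), v) else 0) -
        (if ‖-v‖ ≤ R then G (ι (ballPattern r (reroot S v)), -v) else 0)) with hTr
    set D : Finset (EuclideanSpace ℝ (Fin 3)) → ℝ := fun T => F₁ (ι T) - F₂ (ι T) with hD
    have hsplit : D = Tr + (D - Tr) := (add_sub_cancel Tr D).symm
    have hbd : -η ≤ ℓ n (D - Tr) ∧ ℓ n (D - Tr) ≤ η := by
      refine levelLift_mean_mem_Icc (Ω := fun T => IsRootedPattern δ n T) (H1 n) (H2 n) (H3 n) (H4 n)
        (by linarith) fun T hT => ?_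
      exact abs_le.1 (hest n hnr T hT)
    rw [hsplit, H1, h6, zero_add]
    exact abs_le.2 hbd
  -- the representation pins `∫ (F₁ - F₂) dQ` in `[-η, η]` for every `η > 0`
  refine le_antisymm (le_of_forall_pos_le_add fun η hη => ?_) (le_of_forall_pos_le_add fun η hη => ?_)
  · obtain ⟨n₀, hn₀⟩ := key η hη
    have := (hrepr (fun S => F₁ S - F₂ S) hcF η).2 ⟨n₀, fun n hn => (abs_le.1 (hn₀ n hn)).2⟩
    linarith
  · obtain ⟨n₀, hn₀⟩ := key η hη
    have := (hrepr (fun S => F₁ S - F₂ S) hcF (-η)).1 ⟨n₀, fun n hn => (abs_le.1 (hn₀ n hn)).1⟩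
    linarith

end Summit.AtomisticToContinuum.Crystallization.Theorems.PatternPricedCertificates

end
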